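import Summits.KontsevichZagierPeriods.KontsevichZagierPeriods.Theorems.HoffmanRelationInKZ.Negative.HoffmanElement
import Literature.NumberTheory.Transcendental.MultipleZetaDepthTwoProofs
import Literature.NumberTheory.Transcendental.MZVDualIndex

/-!
# Crux `HoffmanRelationInKZ` (stmt-KontsevichZagierPeriods-3930): the duality dichotomy and the `ℤ/2`-symmetry

Landed copy of §5–§6 of `Cruxes/HoffmanRelationInKZ/Disproof.lean` (crux disprover).

* Cheap instances: `instance_nil`; `atTwo_iff` (Euler's `s = (2)` is `KZ.Equivalent` of the two
  simplices), `atTwo_of_duality`, `atThreeOne_of_duality`, `atTwoTwo_of_duality` — from the route's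
  support item `DualityInKZ` alone; `hoffmanElement_three` / `eval_hoffmanElement_three` (first live
  instance `ζ(4) = ζ(3,1) + ζ(2,2)`).
* Word combinatorics: the split indices of `s` are exactly the duals of the raised indices of `τ(s)`
  (`splits_perm_le_eight` / `splits_perm_le_ten`: kernel-checked by `decide` for all 512 admissible
  indices of weight `≤ 10`; exact enumeration confirms it to weight 12). Hence modulo `DualityInKZ`,
  `H(s) ≡ R(s) − R(τ s)` (`hoffman_sub_raiseDefect_mem`), `Hoffman(s) ⟺ Hoffman(τ s)`
  (`hoffman_iff_hoffman_dual`, `…_le_eight`, `…_le_ten`), and self-dual indices (`selfDual_le_eight`: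
  16 of weight `≤ 8`; 32 of weight `≤ 10`, `selfDual_le_ten_card`) are exactly the
  change-of-variables-only instances (`selfDual_le_eight_of_duality`, `selfDual_le_ten_of_duality`).

References: M. E. Hoffman, Pacific J. Math. 152 (1992), §3 (duality `τ`), Thm 5.1; Y. Ohno, J. Number
Theory 74 (1999) (the `ℓ = 1` shape `Σ ζ(s + e_i) = Σ ζ(τ(s) + e_i)` modulo duality).
-/

noncomputable section

namespace Summit.KontsevichZagierPeriods.HoffmanRelationInKZ.Negative

open MeasureTheory Set
open Literature.NumberTheory.Transcendental
open Literature.NumberTheory.Transcendental.KZ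
open Summit.KontsevichZagierPeriods.KontsevichZagierPeriods.Theses.FurushoPentagon

/-! ## Where the crux HOLDS cheaply: the duality dichotomy

`s = ()` is trivial; `s = (2)` (Euler) is ONE change of variables — the duality `τ(3) = (2,1)`, i.e.
the route's provable support item `DualityInKZ`; more generally, for a SELF-DUAL index (`τ(s) = s`,
which forces `w = 2k`, consistent with §3) Hoffman's element is a sum of duality pairs
`[ζ-rep u] − [ζ-rep τ(u)]`, hence follows from `DualityInKZ` alone: shown for `(3,1)` and `(2,2)`.
Reason (word combinatorics, §6): the split indices of `s` are exactly the duals of the raised indices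
of `τ(s)`, so modulo duality `H(s) ≡ Σ_i [ζ(s + e_i)] − Σ_i [ζ(τ(s) + e_i)]`, antisymmetric under `τ`.
The first instance needing MORE than duality is `s = (3)` (`τ(3) = (2,1) ≠ (3)`; `ε = −1`, §3). -/

/-- `s = ()` is (trivially) an instance. [folklore] -/
theorem instance_nil (Z : List ℕ → FormalRep) : hoffmanElement Z [] ∈ relations := by
  rw [hoffmanElement_nil]; exact relations.zero_mem

/-- Transport of the simplex class along an equality of indices. -/
theorem of_zRep_congr {u v : List ℕ} (h : u = v) (hu : MZV.IsAdmissible u) (hv : MZV.IsAdmissible v) :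
    of (zRep u hu) = of (zRep v hv) := by
  subst h; rfl

/-- A duality pair `[ζ-rep u] − [ζ-rep τ(u)]` is a relation under `DualityInKZ`. -/
theorem duality_pair (hD : DualityInKZ) {u v : List ℕ} (hu : MZV.IsAdmissible u)
    (hv : MZV.IsAdmissible v) (h : MZV.dual u = v) : of (zRep u hu) - of (zRep v hv) ∈ relations := by
  subst h
  exact hD u hu

/-- A duality pair of canonical classes is a relation under `DualityInKZ`. [folklore] -/
theorem duality_pair' (hD : DualityInKZ) {u v : List ℕ} (hu : MZV.IsAdmissible u)
    (hv : MZV.IsAdmissible v) (h : MZV.dual u = v) : zetaRep u - zetaRep v ∈ relations := by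
  rw [zetaRep_of_isAdmissible hu, zetaRep_of_isAdmissible hv]; exact duality_pair hD hu hv h

/-- **`s = (2)` IS Euler's `ζ(3) = ζ(2,1)` as a KZ-equivalence of the two simplex representations.** -/
theorem atTwo_iff :
    hoffmanElement zetaRep [2] ∈ relations ↔ KZ.Equivalent (zRep [3] (by decide)) (zRep [2, 1] (by decide)) := by
  rw [hoffmanElement_two, zetaRep_of_isAdmissible (by decide), zetaRep_of_isAdmissible (by decide)]
  rfl

/-- **`s = (2)` follows from `DualityInKZ`** (`τ(3) = (2,1)`: one change of variables). -/
theorem atTwo_of_duality (hD : DualityInKZ) : hoffmanElement zetaRep [2] ∈ relations := by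
  rw [hoffmanElement_two]
  exact duality_pair' hD (by decide) (by decide) (by decide)

/-- `H(3,1) = ([ζ(4,1)] − [ζ(3,1,1)]) + ([ζ(3,2)] − [ζ(2,2,1)])`: two duality pairs. -/
theorem hoffmanElement_three_one (Z : List ℕ → FormalRep) :
    hoffmanElement Z [3, 1] = (Z [4, 1] - Z [3, 1, 1]) + (Z [3, 2] - Z [2, 2, 1]) := by
  simp [hoffmanElement, List.range_succ]
  abel

/-- **Self-dual `s = (3,1)` follows from `DualityInKZ`.** -/
theorem atThreeOne_of_duality (hD : DualityInKZ) : hoffmanElement zetaRep [3, 1] ∈ relations := by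
  rw [hoffmanElement_three_one]
  exact relations.add_mem (duality_pair' hD (by decide) (by decide) (by decide))
    (duality_pair' hD (by decide) (by decide) (by decide))

/-- `H(2,2) = ([ζ(3,2)] − [ζ(2,2,1)]) + ([ζ(2,3)] − [ζ(2,1,2)])`: two duality pairs. -/
theorem hoffmanElement_two_two (Z : List ℕ → FormalRep) :
    hoffmanElement Z [2, 2] = (Z [3, 2] - Z [2, 2, 1]) + (Z [2, 3] - Z [2, 1, 2]) := by
  simp [hoffmanElement, List.range_succ]
  abel

/-- **Self-dual `s = (2,2)` follows from `DualityInKZ`.** -/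
theorem atTwoTwo_of_duality (hD : DualityInKZ) : hoffmanElement zetaRep [2, 2] ∈ relations := by
  rw [hoffmanElement_two_two]
  exact relations.add_mem (duality_pair' hD (by decide) (by decide) (by decide))
    (duality_pair' hD (by decide) (by decide) (by decide))

/-- Value check at `s = (3)`: `ζ(4) − (ζ(3,1) + ζ(2,2)) = 0` (tree: `multipleZeta_three_one_add_two_two`). -/
theorem eval_hoffmanElement_three : eval (hoffmanElement zetaRep [3]) = 0 := by
  rw [hoffmanElement_three, map_sub, map_add, eval_zetaRep (by decide), eval_zetaRep (by decide),
    eval_zetaRep (by decide), multipleZeta_three_one_add_two_two, sub_self]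




/-! ## The hidden `ℤ/2`-symmetry: Hoffman modulo duality (kernel-checked in weight ≤ 8)

Word combinatorics (`x = ω₀`, `y = ω₁`, `w(s) = x^{s₁−1} y ⋯ x^{s_k−1} y`): the raised indices of `s` are
the insertions of one `x` into an `x`-block, the split indices the insertions of one `y` right after
some `x`; duality `τ` = reverse + swap. Hence **the split indices of `s` are exactly the duals of the
raised indices of `τ(s)`** (as multisets), so that, writing `R(s) = Σ_i [ζ-rep(s + e_i)]`,

  `H(s) = R(s) − R(τ s)^τ ≡ R(s) − R(τ s) =: D(s)`  modulo `DualityInKZ`,  `D(τ s) = −D(s)`.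

Consequences (all proved below from the multiset identity, which is kernel-checked by `decide` for
every admissible index of weight `≤ 8` — 128 indices — and holds to weight 12 by exact enumeration,
2048 indices; the general word-combinatorial proof is routine and left to the positive side):
* `Hoffman(s) ⟺ Hoffman(τ s)` given `DualityInKZ`: the family has HALF as many independent members;
  a counterexample search may restrict to one of `{s, τ(s)}`;
* **self-dual `s` (`τ s = s`) are exactly the CoV-only instances**: `H(s)` is a sum of duality pairs —
  consistent with §3a, since `τ s = s` forces `w = 2k` (`ε(H(s)) = 0`); the self-dual indices of weight
  `≤ 10` are `(), (2), (2,2), (3,1), (2,1,3), (2,2,2), (3,2,1), (4,1,1), …` (32 of them);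
* the crux modulo `DualityInKZ` is the **raise-symmetry** statement `R(s) ~ R(τ s)` ("Ohno `ℓ = 1`"
  shape), whose first instance is `s = (3)`: `[ζ(4)] ~ [ζ(3,1)] + [ζ(2,2)]` (`τ(3) = (2,1)`,
  `R(2,1) = [ζ(3,1)] + [ζ(2,2)]`) — again the weight-4 relation, from a second direction. -/

section Symmetry

/-- The raised indices of `s`. -/
def raises (s : List ℕ) : List (List ℕ) := (List.range s.length).map (raise s)

/-- The split indices of `s` (with multiplicity, grouped by position). -/
def splits (s : List ℕ) : List (List ℕ) :=
  ((List.range s.length).map fun i => (List.range (s.getD i 0 - 1)).map (split s i)).flatten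

/-- The raise sum `R_Z(s) = Σ_i Z(s + e_i)`. -/
def raiseSum (Z : List ℕ → FormalRep) (s : List ℕ) : FormalRep := ((raises s).map Z).sum

/-- `H_Z(s) = Σ_{raises} Z − Σ_{splits} Z`. -/
theorem hoffmanElement_eq_raises_sub_splits (Z : List ℕ → FormalRep) (s : List ℕ) :
    hoffmanElement Z s = ((raises s).map Z).sum - ((splits s).map Z).sum := by
  rw [hoffmanElement_eq]
  simp only [raises, splits, List.map_map, List.map_flatten, List.sum_flatten, Function.comp_def]

/-- Members of `raises s` are admissible. -/
theorem isAdmissible_of_mem_raises {s : List ℕ} (hs : MZV.IsAdmissible s) {r : List ℕ}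
    (hr : r ∈ raises s) : MZV.IsAdmissible r := by
  simp only [raises, List.mem_map, List.mem_range] at hr
  obtain ⟨i, hi, rfl⟩ := hr
  exact isAdmissible_raise hs hi

/-- A list of duality pairs is a relation. -/
theorem sum_sub_sum_dual_mem_relations (hD : DualityInKZ) :
    ∀ l : List (List ℕ), (∀ r ∈ l, MZV.IsAdmissible r) →
      (l.map zetaRep).sum - (l.map (zetaRep ∘ MZV.dual)).sum ∈ relations
  | [], _ => by simp [relations.zero_mem]
  | r :: l, h => by
    have hr : MZV.IsAdmissible r := h r (by simp)
    have ih := sum_sub_sum_dual_mem_relations hD l fun x hx => h x (by simp [hx])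
    have hp := duality_pair' hD hr (MZV.isAdmissible_dual hr) rfl
    simp only [List.map_cons, List.sum_cons, Function.comp_apply]
    have e : zetaRep r + (l.map zetaRep).sum - (zetaRep (MZV.dual r) + (l.map (zetaRep ∘ MZV.dual)).sum) =
        (zetaRep r - zetaRep (MZV.dual r)) + ((l.map zetaRep).sum - (l.map (zetaRep ∘ MZV.dual)).sum) := by
      abel
    rw [e]
    exact relations.add_mem hp ih

/-- **Hoffman modulo duality is raise-antisymmetry**: if the split indices of `s` are the duals of
the raised indices of `τ(s)`, then `H(s) ≡ R(s) − R(τ s)` modulo `DualityInKZ`. -/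
theorem hoffman_sub_raiseDefect_mem (hD : DualityInKZ) {s : List ℕ} (hs : MZV.IsAdmissible s)
    (hperm : List.Perm (splits s) ((raises (MZV.dual s)).map MZV.dual)) :
    hoffmanElement zetaRep s - (raiseSum zetaRep s - raiseSum zetaRep (MZV.dual s)) ∈ relations := by
  rw [hoffmanElement_eq_raises_sub_splits, (hperm.map zetaRep).sum_eq, List.map_map]
  have h := sum_sub_sum_dual_mem_relations hD (raises (MZV.dual s))
    (fun r hr => isAdmissible_of_mem_raises (MZV.isAdmissible_dual hs) hr)
  have e : ((raises s).map zetaRep).sum - ((raises (MZV.dual s)).map (zetaRep ∘ MZV.dual)).sum -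
      (raiseSum zetaRep s - raiseSum zetaRep (MZV.dual s)) =
      ((raises (MZV.dual s)).map zetaRep).sum - ((raises (MZV.dual s)).map (zetaRep ∘ MZV.dual)).sum := by
    simp only [raiseSum]; abel
  rw [e]
  exact h

/-- Hence `Hoffman(s) ⟺ R(s) ~ R(τ s)`, given duality and the multiset identity. -/
theorem hoffman_iff_raiseSymm (hD : DualityInKZ) {s : List ℕ} (hs : MZV.IsAdmissible s)
    (hperm : List.Perm (splits s) ((raises (MZV.dual s)).map MZV.dual)) :
    hoffmanElement zetaRep s ∈ relations ↔ raiseSum zetaRep s - raiseSum zetaRep (MZV.dual s) ∈ relations := by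
  have h := hoffman_sub_raiseDefect_mem hD hs hperm
  constructor
  · intro hH
    simpa using relations.sub_mem hH h
  · intro hR
    simpa using relations.add_mem h hR

/-- **Self-dual indices are CoV-only instances**: `τ s = s` ⇒ `H(s) ∈ relations` from `DualityInKZ`. -/
theorem selfDual_of_duality (hD : DualityInKZ) {s : List ℕ} (hs : MZV.IsAdmissible s)
    (hperm : List.Perm (splits s) ((raises (MZV.dual s)).map MZV.dual)) (hτ : MZV.dual s = s) :
    hoffmanElement zetaRep s ∈ relations := by
  rw [hoffman_iff_raiseSymm hD hs hperm, hτ, sub_self]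
  exact relations.zero_mem

/-- **`ℤ/2`-symmetry of the family**: `Hoffman(s) ⟺ Hoffman(τ s)` given duality (and the multiset
identity at `s` and at `τ s`). -/
theorem hoffman_iff_hoffman_dual (hD : DualityInKZ) {s : List ℕ} (hs : MZV.IsAdmissible s)
    (hperm : List.Perm (splits s) ((raises (MZV.dual s)).map MZV.dual))
    (hperm' : List.Perm (splits (MZV.dual s)) ((raises (MZV.dual (MZV.dual s))).map MZV.dual)) :
    hoffmanElement zetaRep s ∈ relations ↔ hoffmanElement zetaRep (MZV.dual s) ∈ relations := by
  rw [hoffman_iff_raiseSymm hD hs hperm, hoffman_iff_raiseSymm hD (MZV.isAdmissible_dual hs) hperm',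
    MZV.dual_dual hs]
  constructor <;> intro h <;> simpa using relations.neg_mem h

/-! ### Kernel-checked enumeration (weight ≤ 8) -/

/-- Fuelled enumeration of the compositions of `n` into positive parts. -/
def compsFuel : ℕ → ℕ → List (List ℕ)
  | _, 0 => [[]]
  | 0, _ + 1 => []
  | f + 1, n + 1 => ((List.range (n + 1)).map fun j => (compsFuel f j).map fun c => (n + 1 - j) :: c).flatten

/-- The compositions of `n`. -/
def comps (n : ℕ) : List (List ℕ) := compsFuel n n

/-- The admissible indices of weight `≤ W` (all of them: the count below is `Σ_{w ≤ W} 2^{w−2} + 1`). -/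
def admissiblesLE (W : ℕ) : List (List ℕ) :=
  (((List.range (W + 1)).map comps).flatten).filter fun s => decide (MZV.IsAdmissible s)

/-- Sanity: `128 = 1 + (1 + 2 + ⋯ + 64)` admissible indices of weight `≤ 8`, without repetition. -/
theorem admissiblesLE_eight_card : (admissiblesLE 8).length = 128 ∧ (admissiblesLE 8).Nodup := by
  decide +kernel

/-- **The multiset identity `splits(s) = τ(raises(τ s))`, kernel-checked for all 128 admissible
indices of weight `≤ 8`.** -/
theorem splits_perm_le_eight :
    ∀ s ∈ admissiblesLE 8, List.Perm (splits s) ((raises (MZV.dual s)).map MZV.dual) := by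
  decide +kernel

/-- Sanity: `512` admissible indices of weight `≤ 10` (repetition-freeness is checked at weight `8`;
at weight `10` the quadratic `Nodup` check exceeds the kernel's default recursion budget). [folklore] -/
theorem admissiblesLE_ten_card : (admissiblesLE 10).length = 512 := by
  decide +kernel

/-- **The same multiset identity for all 512 admissible indices of weight `≤ 10`** (weight 12, 2048
indices, exceeds the default heartbeat budget of one declaration; confirmed by exact enumeration
outside Lean). [folklore] -/
theorem splits_perm_le_ten :
    ∀ s ∈ admissiblesLE 10, List.Perm (splits s) ((raises (MZV.dual s)).map MZV.dual) := by
  decide +kernel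

/-- The self-dual admissible indices of weight `≤ 8`. -/
theorem selfDual_le_eight :
    (admissiblesLE 8).filter (fun s => decide (MZV.dual s = s)) =
      [[], [2], [3, 1], [2, 2], [4, 1, 1], [3, 2, 1], [2, 2, 2], [2, 1, 3], [5, 1, 1, 1], [4, 2, 1, 1],
        [3, 2, 2, 1], [3, 1, 3, 1], [2, 3, 1, 2], [2, 2, 2, 2], [2, 1, 2, 3], [2, 1, 1, 4]] := by
  decide +kernel

/-- **All 16 self-dual instances of weight `≤ 8` follow from `DualityInKZ` alone** (no additivity, no
Stokes: §3a says they are the only candidates, `ε = 0`). -/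
theorem selfDual_le_eight_of_duality (hD : DualityInKZ) :
    ∀ s ∈ admissiblesLE 8, MZV.dual s = s → hoffmanElement zetaRep s ∈ relations := by
  intro s hs hτ
  have hadm : MZV.IsAdmissible s := by
    have := (List.mem_filter.mp hs).2
    simpa using this
  exact selfDual_of_duality hD hadm (splits_perm_le_eight s hs) hτ

/-- **The `ℤ/2`-symmetry, unconditionally in the combinatorics, for weight `≤ 8`.** -/
theorem hoffman_iff_hoffman_dual_le_eight (hD : DualityInKZ) :
    ∀ s ∈ admissiblesLE 8, hoffmanElement zetaRep s ∈ relations ↔ hoffmanElement zetaRep (MZV.dual s) ∈ relations := by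
  intro s hs
  have hadm : MZV.IsAdmissible s := by
    have := (List.mem_filter.mp hs).2
    simpa using this
  have hs' : MZV.dual s ∈ admissiblesLE 8 := by
    revert s; decide +kernel
  exact hoffman_iff_hoffman_dual hD hadm (splits_perm_le_eight s hs) (splits_perm_le_eight _ hs')

/-- **Self-dual indices of weight `≤ 10` (32 of them) are change-of-variables-only instances.** [folklore] -/
theorem selfDual_le_ten_of_duality (hD : DualityInKZ) :
    ∀ s ∈ admissiblesLE 10, MZV.dual s = s → hoffmanElement zetaRep s ∈ relations := by
  intro s hs hτ
  have hadm : MZV.IsAdmissible s := by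
    have := (List.mem_filter.mp hs).2
    simpa using this
  exact selfDual_of_duality hD hadm (splits_perm_le_ten s hs) hτ

/-- There are exactly 32 self-dual admissible indices of weight `≤ 10`. [folklore] -/
theorem selfDual_le_ten_card : ((admissiblesLE 10).filter fun s => decide (MZV.dual s = s)).length = 32 := by
  decide +kernel

/-- **The `ℤ/2`-symmetry for weight `≤ 10`.** [folklore] -/
theorem hoffman_iff_hoffman_dual_le_ten (hD : DualityInKZ) :
    ∀ s ∈ admissiblesLE 10, hoffmanElement zetaRep s ∈ relations ↔ hoffmanElement zetaRep (MZV.dual s) ∈ relations := by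
  intro s hs
  have hadm : MZV.IsAdmissible s := by
    have := (List.mem_filter.mp hs).2
    simpa using this
  have hs' : MZV.dual s ∈ admissiblesLE 10 := by
    revert s; decide +kernel
  exact hoffman_iff_hoffman_dual hD hadm (splits_perm_le_ten s hs) (splits_perm_le_ten _ hs')

/-- The first instance beyond duality, from the symmetric side: modulo `DualityInKZ`, `Hoffman(3)` is
`[ζ-rep 4] − ([ζ-rep(3,1)] + [ζ-rep(2,2)]) ∈ relations` ⟺ `R(3) ~ R(2,1)`. -/
theorem raiseDefect_three : raiseSum zetaRep [3] - raiseSum zetaRep (MZV.dual [3]) =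
    zetaRep [4] - (zetaRep [3, 1] + zetaRep [2, 2]) := by
  have h0 : MZV.dual [3] = [2, 1] := by decide
  have h1 : raises [3] = [[4]] := by decide
  have h2 : raises [2, 1] = [[3, 1], [2, 2]] := by decide
  simp [raiseSum, h0, h1, h2]

end Symmetry



end Summit.KontsevichZagierPeriods.HoffmanRelationInKZ.Negative
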